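import Mathlib
import Literature.Computability.AlgebraicComplexity.NestFreeMatchingPoly
import HarnessLib

/-!
# The FIFO (queue) pairing of a ballot word is a nest-free perfect matching

Topic `Computability/AlgebraicComplexity`, companion of `NestFreeMatchingPoly.lean` (the follow-up
announced there: "the FIFO description of `NN_n`").  Definitions + proved API, no named facts.

**The notion, as printed.** Grytczuk–Pawlik–Ruciński 2025, p. 8 and Prop. 1: the twins
`X = w_{i_1} ⋯ w_{i_t}`, `Y = w_{j_1} ⋯ w_{j_t}` (`i_1 < ⋯ < i_t`, `j_1 < ⋯ < j_t`, `i_h < j_h`) of a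
shuffle square give the matching `{i_1, j_1}, …, {i_t, j_t}`, and "clearly, there are no nests in
`M`" — nest-free perfect matchings are the FIFO (queue) pairings "`h`-th letter of `X` with `h`-th
letter of `Y`"; Stanley EC2, Ex. 6.19(ww) (nonnesting matchings ↔ ballot sequences, as cited in
Chen–Deng–Du–Stanley–Yan 2007, §1).

**Encoding.** A word is `w : Fin m → Bool` (`true` = opener / push, `false` = closer / pop);
`openerSet w`, `closerSet w` are the two position sets.  When they have the same size
(`h : #closerSet = #openerSet`), `fifo w h : Fin m → Fin m` pairs the `k`-th opener with the `k`-th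
closer (both read off `Finset.orderEmbOfFin`).  The word is a *ballot word* (`IsBallot w h`) if the
`k`-th opener precedes the `k`-th closer for every `k` (the prefix condition of ballot sequences in
the form that is used; the count form is not needed here).

## Contents

* `fifo_opener`, `fifo_closer` (the `k`-th opener and the `k`-th closer are exchanged),
  `fifo_fifo` (involution), `fifo_ne` (no fixed point), `lt_fifo_iff` (under `IsBallot`: `i < fifo i`
  iff `i` is an opener), `fifo_nonnest` (no two arcs nest), and
  `fifo_mem_nestFreeMatchings` — **the FIFO pairing of a ballot word is a nest-free perfect
  matching** in the sense of `nestFreeMatchings` (the route `FifoMatching`'s literal predicate);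
* `respects_fifo_iff` — a set `S` of positions is a union of arcs of `fifo w h`
  (`∀ i, i ∈ S ↔ fifo w h i ∈ S`) iff for every `k` the `k`-th opener and the `k`-th closer lie on
  the same side of `S` (the form used by monotone lower-bound arguments for `NN_n`, which weight
  matchings through their words).

## Not here

The converse (every nest-free perfect matching is the FIFO pairing of its opener word, so that
`fifo` is a bijection from ballot words onto `nestFreeMatchings`), and the count form of the ballot
condition; neither is needed by the first user (route `FifoMatching`, crux `NNMonotoneHard`).
-/

noncomputable section

namespace Literature.Computability.AlgebraicComplexity

open Finset

variable {m : ℕ}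

/-- The set of opener positions (letters `true`) of a word. [cite: GrytczukPawlikRucinski2025, §2.1 and Prop. 1] -/
def openerSet (w : Fin m → Bool) : Finset (Fin m) :=
  univ.filter fun i => w i = true

/-- The set of closer positions (letters `false`) of a word. [cite: GrytczukPawlikRucinski2025, §2.1 and Prop. 1] -/
def closerSet (w : Fin m → Bool) : Finset (Fin m) :=
  univ.filter fun i => w i = false

/-- Membership in the opener set. [cite: GrytczukPawlikRucinski2025, §2.1 (FIFO pairing), API] -/
@[simp]
theorem mem_openerSet {w : Fin m → Bool} {i : Fin m} : i ∈ openerSet w ↔ w i = true :=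
  mem_filter.trans (and_iff_right (mem_univ _))

/-- Membership in the closer set. [cite: GrytczukPawlikRucinski2025, §2.1 (FIFO pairing), API] -/
@[simp]
theorem mem_closerSet {w : Fin m → Bool} {i : Fin m} : i ∈ closerSet w ↔ w i = false :=
  mem_filter.trans (and_iff_right (mem_univ _))

/-- **The FIFO (queue) pairing** of a word with as many closers as openers: the `k`-th opener is
paired with the `k`-th closer and conversely ("`h`-th letter of `X` with `h`-th letter of `Y`").
[cite: GrytczukPawlikRucinski2025, Prop. 1] -/
def fifo (w : Fin m → Bool) (h : (closerSet w).card = (openerSet w).card) : Fin m → Fin m :=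
  fun i =>
    if hi : w i = true then
      (closerSet w).orderEmbOfFin h
        (((openerSet w).orderIsoOfFin rfl).symm ⟨i, mem_openerSet.2 hi⟩)
    else
      (openerSet w).orderEmbOfFin rfl
        (((closerSet w).orderIsoOfFin h).symm ⟨i, mem_closerSet.2 (Bool.eq_false_iff.2 hi)⟩)

/-- A word with as many closers as openers is a **ballot word** if its `k`-th opener precedes its
`k`-th closer for every `k` (equivalently: every prefix has at least as many openers as closers).
[cite: ChenDengDuStanleyYan2007, §1] -/
def IsBallot (w : Fin m → Bool) (h : (closerSet w).card = (openerSet w).card) : Prop :=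
  ∀ k : Fin (openerSet w).card,
    (openerSet w).orderEmbOfFin rfl k < (closerSet w).orderEmbOfFin h k

section API

variable {w : Fin m → Bool} {h : (closerSet w).card = (openerSet w).card}

/-- The `k`-th opener is an opener. [cite: GrytczukPawlikRucinski2025, §2.1 (FIFO pairing), API] -/
theorem apply_opener (k : Fin (openerSet w).card) : w ((openerSet w).orderEmbOfFin rfl k) = true :=
  mem_openerSet.1 (orderEmbOfFin_mem _ _ k)

/-- The `k`-th closer is a closer. [cite: GrytczukPawlikRucinski2025, §2.1 (FIFO pairing), API] -/
theorem apply_closer (h : (closerSet w).card = (openerSet w).card) (k : Fin (openerSet w).card) :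
    w ((closerSet w).orderEmbOfFin h k) = false :=
  mem_closerSet.1 (orderEmbOfFin_mem _ _ k)

/-- Every opener is the `k`-th opener for some `k`. [cite: GrytczukPawlikRucinski2025, §2.1 (FIFO pairing), API] -/
theorem exists_eq_opener {i : Fin m} (hi : w i = true) :
    ∃ k : Fin (openerSet w).card, (openerSet w).orderEmbOfFin rfl k = i := by
  have : i ∈ Set.range ((openerSet w).orderEmbOfFin rfl) := by
    rw [range_orderEmbOfFin]; exact mem_coe.2 (mem_openerSet.2 hi)
  exact this

/-- Every closer is the `k`-th closer for some `k`. [cite: GrytczukPawlikRucinski2025, §2.1 (FIFO pairing), API] -/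
theorem exists_eq_closer (h : (closerSet w).card = (openerSet w).card) {i : Fin m}
    (hi : w i = false) : ∃ k : Fin (openerSet w).card, (closerSet w).orderEmbOfFin h k = i := by
  have : i ∈ Set.range ((closerSet w).orderEmbOfFin h) := by
    rw [range_orderEmbOfFin]; exact mem_coe.2 (mem_closerSet.2 hi)
  exact this

/-- **FIFO pairs the `k`-th opener with the `k`-th closer.** [cite: GrytczukPawlikRucinski2025, Prop. 1] -/
theorem fifo_opener (k : Fin (openerSet w).card) :
    fifo w h ((openerSet w).orderEmbOfFin rfl k) = (closerSet w).orderEmbOfFin h k := by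
  unfold fifo
  rw [dif_pos (apply_opener k)]
  congr 1
  apply ((openerSet w).orderIsoOfFin rfl).symm_apply_eq.2
  exact Subtype.ext (coe_orderIsoOfFin_apply _ _ k).symm

/-- **FIFO pairs the `k`-th closer with the `k`-th opener.** [cite: GrytczukPawlikRucinski2025, Prop. 1] -/
theorem fifo_closer (k : Fin (openerSet w).card) :
    fifo w h ((closerSet w).orderEmbOfFin h k) = (openerSet w).orderEmbOfFin rfl k := by
  unfold fifo
  rw [dif_neg (by rw [apply_closer h k]; exact Bool.false_ne_true)]
  congr 1
  apply ((closerSet w).orderIsoOfFin h).symm_apply_eq.2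
  exact Subtype.ext (coe_orderIsoOfFin_apply _ _ k).symm

/-- The FIFO pairing is an involution. [cite: GrytczukPawlikRucinski2025, §2.1 (FIFO pairing), API] -/
theorem fifo_fifo (i : Fin m) : fifo w h (fifo w h i) = i := by
  by_cases hi : w i = true
  · obtain ⟨k, rfl⟩ := exists_eq_opener hi
    rw [fifo_opener, fifo_closer]
  · obtain ⟨k, rfl⟩ := exists_eq_closer h (Bool.eq_false_iff.2 hi)
    rw [fifo_closer, fifo_opener]

/-- The FIFO pairing has no fixed point (it exchanges openers and closers). [cite: GrytczukPawlikRucinski2025, §2.1 (FIFO pairing), API] -/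
theorem fifo_ne (i : Fin m) : fifo w h i ≠ i := by
  by_cases hi : w i = true
  · obtain ⟨k, rfl⟩ := exists_eq_opener hi
    rw [fifo_opener]
    intro e
    have h1 := apply_closer h k
    rw [e, apply_opener k] at h1
    exact Bool.noConfusion h1
  · obtain ⟨k, rfl⟩ := exists_eq_closer h (Bool.eq_false_iff.2 hi)
    rw [fifo_closer]
    intro e
    have h1 := apply_opener (w := w) k
    rw [e, apply_closer h k] at h1
    exact Bool.noConfusion h1

/-- For a ballot word, `i < fifo i` exactly when `i` is an opener. [cite: ChenDengDuStanleyYan2007, §1] -/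
theorem lt_fifo_iff (hb : IsBallot w h) (i : Fin m) : i < fifo w h i ↔ w i = true := by
  by_cases hi : w i = true
  · obtain ⟨k, rfl⟩ := exists_eq_opener hi
    rw [fifo_opener]
    exact iff_of_true (hb k) (apply_opener k)
  · obtain ⟨k, rfl⟩ := exists_eq_closer h (Bool.eq_false_iff.2 hi)
    rw [fifo_closer, apply_closer h k]
    exact iff_of_false (lt_asymm (hb k)) Bool.false_ne_true

/-- **No two FIFO arcs nest** (for a ballot word): there are no `i < j < fifo j < fifo i`.
Openers and closers are paired in the same order, so a later opener closes later.
[cite: GrytczukPawlikRucinski2025, Prop. 1] -/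
theorem fifo_nonnest (hb : IsBallot w h) {i j : Fin m} (hij : i < j) (hj : j < fifo w h j)
    (hji : fifo w h j < fifo w h i) : False := by
  have hjo : w j = true := (lt_fifo_iff hb j).1 hj
  obtain ⟨l, rfl⟩ := exists_eq_opener hjo
  rw [fifo_opener] at hji hj
  by_cases hi : w i = true
  · obtain ⟨k, rfl⟩ := exists_eq_opener hi
    rw [fifo_opener] at hji
    have hkl : k < l := ((openerSet w).orderEmbOfFin rfl).lt_iff_lt.1 hij
    exact lt_asymm (((closerSet w).orderEmbOfFin h).lt_iff_lt.2 hkl) hji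
  · obtain ⟨k, rfl⟩ := exists_eq_closer h (Bool.eq_false_iff.2 hi)
    rw [fifo_closer] at hji
    have h1 : (openerSet w).orderEmbOfFin rfl k < (closerSet w).orderEmbOfFin h k := hb k
    exact lt_asymm (lt_trans (lt_trans h1 hij) hj) hji

/-- **The FIFO pairing of a ballot word is a nest-free perfect matching** (a member of
`nestFreeMatchings m`, the literal predicate of route `FifoMatching`).
[cite: GrytczukPawlikRucinski2025, Prop. 1] -/
theorem fifo_mem_nestFreeMatchings (hb : IsBallot w h) : fifo w h ∈ nestFreeMatchings m := by
  rw [mem_nestFreeMatchings, mem_perfectMatchings]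
  exact ⟨⟨fifo_fifo, fifo_ne⟩, fun i j hij hj hji => fifo_nonnest hb hij hj hji⟩

/-- The openers of the FIFO matching of a ballot word are the openers of the word. [cite: GrytczukPawlikRucinski2025, §2.1 (FIFO pairing), API] -/
theorem mem_openers_fifo_iff (hb : IsBallot w h) (i : Fin m) :
    i ∈ openers (fifo w h) ↔ w i = true := by
  rw [mem_openers, lt_fifo_iff hb]

/-- **A set of positions is a union of FIFO arcs iff, for every `k`, the `k`-th opener and the
`k`-th closer lie on the same side of it.** [cite: GrytczukPawlikRucinski2025, §2.1 (FIFO pairing), API] -/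
theorem respects_fifo_iff (S : Finset (Fin m)) :
    (∀ i, i ∈ S ↔ fifo w h i ∈ S) ↔
      ∀ k : Fin (openerSet w).card,
        ((openerSet w).orderEmbOfFin rfl k ∈ S ↔ (closerSet w).orderEmbOfFin h k ∈ S) := by
  constructor
  · intro hS k
    rw [hS ((openerSet w).orderEmbOfFin rfl k), fifo_opener]
  · intro hS i
    by_cases hi : w i = true
    · obtain ⟨k, rfl⟩ := exists_eq_opener hi
      rw [fifo_opener]
      exact hS k
    · obtain ⟨k, rfl⟩ := exists_eq_closer h (Bool.eq_false_iff.2 hi)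
      rw [fifo_closer]
      exact (hS k).symm

end API

end Literature.Computability.AlgebraicComplexity
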